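import Summits.HodgeConjecture.HodgeConjecture.Theorems.R90S9HcoeffMemBinderOfLevels        -- ★ p862816 (this seat, (CMP-L2)): `hcoeffMem_binder_gammaSph_recordSCD_ofLevels_unit'`
import Summits.HodgeConjecture.HodgeConjecture.Theorems.F0P3XiSideOfRecordSCD               -- ★ (F0∕P3): `hFinU_of_xiLocalPacketUnitarySCD` — members of the SCD record unitarizable from the letter `XiLocalPacketUnitary`
import Summits.HodgeConjecture.HodgeConjecture.Theorems.F0P3bXiLocalPacketUnitaryOfStubs    -- ★ (F0∕P3b): `xiLocalPacketUnitary_of_letterD` (+ ★ `isUnitarizable_of_isSupercuspidal`, ★ compact centre at non-split `v`)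
import Summits.HodgeConjecture.HodgeConjecture.Theorems.F0P2oLocalLettersHold               -- ★ p839396 (F0∕P2): `xiLocalPacket_nonsplit_isThetaPair_holds` — letter D, HYPOTHESIS-FREE
import Summits.HodgeConjecture.HodgeConjecture.Theorems.F0P3XiPacketFamilyOfRecordGlue       -- ★ (F0∕P3, B-p08): `hexc_of_xiPinSphericalCofinite` — the record letter `hexc` read on the Keys data from letter #79
import Summits.HodgeConjecture.HodgeConjecture.Theorems.F0P3XiPinSphericalCofiniteHolds      -- ★ (F0∕P3): `xiPinSphericalCofinite_holds` — letter #79 «XP» [Rogawski1990 Thm. 13.3.6 (b)], HYPOTHESIS-FREE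
import HarnessLib

/-!
# R90-TF · S9 «InnerForm-13.3.6 (c)» — (CMP-L3) THE Ξ-SLOT LETTERS `hun` ∕ `hus` ∕ `hne` AND THE RECORD LETTER `hexc` OF THE (CMP) BINDER, PAID AT THE PACKET FAMILY OF RECORD
# `Ξ₀ := xiPacketFamilyOfRecordSCD` (Rogawski 1990 §12.2 (1)–(2) pp. 173–174, §13.1 Prop. 13.1.3 (d) p. 199; used in the proof of Thm. 14.6.4, p. 245 l. 1–4)

Cell `hodgecm-mathlib`, crux H413 (`stmt-HodgeConjecture-24833`, lane `--supports … --as helper`), route of record `HCCMUnconditional` (no route verbs;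
count-neutral).  Programme R90-TF (HUMAN RULING «R90-TF SLAB — MAX PUSH»; brief `director/R90-BRIEF.v2.md` 1f40d54518340a35), section S9 = InnerForm-13.3.6 (c)
(base `R90-IF`); seat R90-IF-p03 (g3), (CMP) lineage (★ p862176 → … → p862730 → p862816).  SELF-DEALT DEFAULT (CMP-L3) within deal (8) of R90-IF-plan (g2) DEALS #1
(R90 bus 2026-09-04T23:0xZ; silence = «=»).
WHY: among the residual letters of ★ (CMP-L2) `hcoeffMem_binder_gammaSph_recordSCD_ofLevels_unit'` (p862816), three are facts about the MEMBERS of the A-packet family of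
record `Ξ₀ ξ v = {πⁿ(ξ_v), πˢ(ξ_v)}`: `hun` («`πⁿ(ξ_v)` is unitarizable, every `v`»), `hus` («`πˢ(ξ_v)` is unitarizable at the two-member places»), `hne` («`πˢ(ξ_v) ≠ πⁿ(ξ_v)`
at the two-member places»), and one is the record letter `hexc` («the Keys label `πⁿ` is `K_v`-spherical at almost every non-split `v`»).  At the SCD record they are PROVABLE NOW from ★ material, once the two-member places are NON-SPLIT (print: `Π(ξ_v)` has two members exactly
at the places of `L⁺` that do not split in `L`): (ⅰ) `πⁿ`: split `v` — the member of the ★ D6 split packet is unitarily induced from unit-norm characters (★ p825402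
`splitMemberGL_isUnitarizable`); non-split `v` — the Keys label is the theta type `X_v(μ, εₙ, χ_f)` by letter D [GelbartRogawski1991, Lem. 5.1.2], ★ HYPOTHESIS-FREE since
p839396 `xiLocalPacket_nonsplit_isThetaPair_holds`, hence unitarizable (★ `xiLocalPacketUnitary_of_letterD`), transported along the form congruence (★ `isUnitarizable_comap`)
— packaged as ★ `hFinU_of_xiLocalPacketUnitarySCD`; (ⅱ) `πˢ` at non-split `v` is SUPERCUSPIDAL (the record's own `hSC` clause) and the centre of `U(H)(L⁺_v)` is compact at a
non-split `v` (★ `local_nonsplit_compactOpen_center_of_center_le` + ★ `forall_mem_center_cmLocal_eq_scalar`), so it is unitarizable (★ `isUnitarizable_of_isSupercuspidal`,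
[BushnellHenniart2006, §11.1]); (ⅲ) `πˢ ≠ πⁿ` at non-split `v` is the record's own `hSC` clause; (ⅳ) `hexc` is letter #79 «XP» [Rogawski1990, Thm. 13.3.6 (b)], ★ HYPOTHESIS-FREE since
`xiPinSphericalCofinite_holds`, read on the Keys data by ★ `hexc_of_xiPinSphericalCofinite` (B-p08).  NEW HYPOTHESES this costs, all already carried by ★ (δ1)∕(δ5) or by
FILE B's prefix: `hμω` (`μω|_{𝕀_{L⁺}} = ω_{L/L⁺}`, (δ1) :116), `[BorelSpace (U(Φ₃)(L⁺_v)⧸Z)]`, `[(μZ v).IsHaarMeasure]` ((δ1) :155–:158), `hquad` (the local quadratic-character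
clause at non-split `v`, the `hquad` of B's `keys` pin ★ `exists_keysData_of_keysCaseTwo`), and the one-line law `hp` «two-member places are non-split» (at `p := non-split`:
`fun _ _ _ h => h`).
THEOREMS ONLY: no `def`, no instance, no notation, no named fact, no `sorry`; imports ★ `Theorems` only; namespace `Summit.HodgeConjecture.HodgeConjecture.R90.S9`.
HONEST LABEL: HC_CM is proved only modulo the 7 printed citations (2 remaining named inputs: hLiu418 = stmt-HodgeConjecture-24832, h413 = stmt-HodgeConjecture-24833)
— until rung 0 closes.  §1 are facts about the record (kernel-checked from ★ parts, letter D ★); §2 is pure composition.  Residual (CMP) letters after this file: `htrX`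
(`rfl` at `X_cm`), F1b ∕ «ARCH», `p` + `hp` (:= non-split), `a₀ ha₀` (S2), `T₀ hn1 hs0 hR₁ hR₂` (S2∕S3∕S7), `hex` (S6, shared with (MN)), the guarded level tuple + `hlifts hn hnH`
(shared with (MN)).

## What is here (sorry-free, axioms ⊆ {propext, Classical.choice, Quot.sound})
* §1 (the record `Ξ₀ := xiPacketFamilyOfRecordSCD … μZ keys hSC`, any `ξ`): `πs_getD_ne_πn_recordSCD_of_nonsplit` (= `hne`), `isSupercuspidal_πs_getD_recordSCD_of_nonsplit`,
  `isUnitarizable_πs_getD_recordSCD_of_nonsplit` (= `hus`), `isUnitarizable_πn_recordSCD` (= `hun`; needs `hμω` + the Haar frame on `μZ`).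
* §2 **`hcoeffMem_binder_gammaSph_recordSCD_ofLevels_unit_slots'`** — ★ (CMP-L2) `…_ofLevels_unit'` with `hun hus hne` DISCHARGED by §1 (under `hp`) and `hexc`
  DISCHARGED by ★ `hexc_of_xiPinSphericalCofinite … (xiPinSphericalCofinite_holds L)` (under `hquad`); conclusion = the (δ1)∕(δ5) `hcoeffMem` binder type, token for token.

[cite: Rogawski1990, §12.2 (1)–(2) pp. 173–174; §13.1 Prop. 13.1.3 (d), Prop. 13.1.4 p. 199; §4.13 Lemma 4.13.1 (b); §14.6 Thm. 14.6.4 with its proof pp. 244–245 (chunks p0238 L9 – p0239 L4)]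
[cite: Rogawski1990, §13.3 Thm. 13.3.6 (b) p. 202] [cite: GelbartRogawski1991, Lem. 5.1.2 p. 466] [cite: BushnellHenniart2006, §11.1] [cite: FlathCorvallis1979, Thm. 3 and Thm. 4]
-/

set_option autoImplicit false
-- the mandated namespace repeats `HodgeConjecture.HodgeConjecture`, as in every `Theorems/*.lean` of this sub-problem
set_option linter.dupNamespace false

noncomputable section

namespace Summit.HodgeConjecture.HodgeConjecture.R90.S9

open Finset Filter
open Literature.NumberTheory Literature.NumberTheory.Automorphic Literature.NumberTheory.GaloisRepresentations
open NumberField IsDedekindDomain MeasureTheory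
open Literature.NumberTheory.Rogawski1990 Literature.NumberTheory.Automorphic.UnitaryGroup
open Literature.NumberTheory.Automorphic.UnitaryGroup.CotangentForms (cmCompactFactor)
open Literature.RepresentationTheory.KonnoKonno2007 Literature.RepresentationTheory.KonnoKonno2007.RealDualPair
open Literature.RepresentationTheory.KonnoKonno2007.RealDualPair.UForm
open Summit.HodgeConjecture.HodgeConjecture.Cruxes.H413 Summit.HodgeConjecture.HodgeConjecture.Cruxes.H413.F0P3ClassTokenChoice
open Summit.HodgeConjecture.HodgeConjecture.Cruxes.H413.F0P3GlobalPacket Summit.HodgeConjecture.HodgeConjecture.Cruxes.H413.F0P3LocalPacketKit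
open Summit.HodgeConjecture.HodgeConjecture.Cruxes.H413.F0P3XiLocalFamilyOfRecord Summit.HodgeConjecture.HodgeConjecture.Cruxes.H413.F0P3XiPacketFamilyOfRecord
open Summit.HodgeConjecture.HodgeConjecture.Cruxes.H413.F0P3XiPacketFamilyOfRecordSCD
open InnerFormSec146
open scoped Matrix MatrixGroups Classical ComplexOrder

section Record

variable (L : Type) [Field L] [NumberField L] [IsCMField L] (ι₀ : L →+* ℂ) (H : Matrix (Fin 3) (Fin 3) L)
  (T : GL (Fin 3) ℂ) (hT : (T : Matrix (Fin 3) (Fin 3) ℂ)ᴴ * H.map ι₀ * (T : Matrix (Fin 3) (Fin 3) ℂ) = Literature.Geometry.ComplexHyperbolic.BallModel.J)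
  (νinf : @Measure (UnitaryGroup.arch (↥(maximalRealSubfield L)) L (IsCMField.complexConj L) 3 H) (borel _))
  (μv : ∀ v : HeightOneSpectrum (𝓞 ↥(maximalRealSubfield L)), @Measure ((cmDatum L 3 H).Local v) (borel _))
  (hdef : ∀ τ' : L →+* ℂ, InfinitePlace.mk τ' ≠ InfinitePlace.mk ι₀ → (H.map τ').PosDef)
  (hν : @Measure.IsHaarMeasure _ _ _ (borel _) νinf)
  (hμ : ∀ v : HeightOneSpectrum (𝓞 ↥(maximalRealSubfield L)), @Measure.IsHaarMeasure _ _ _ (borel _) (μv v))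
  -- the SCD record data (★ `F0P3XiPacketFamilyOfRecordSCD`, token for token)
  (hH : (H.map (cmConjRingHom L))ᵀ = H) (hHd : IsUnit H.det) (μω : HeckeCharacter L) (hμu : μω.IsUnitary)
  [∀ v : HeightOneSpectrum (𝓞 ↥(maximalRealSubfield L)), MeasurableSpace (Gqs L v ⧸ Subgroup.center (Gqs L v))]
  (μZ : ∀ v : HeightOneSpectrum (𝓞 ↥(maximalRealSubfield L)), Measure (Gqs L v ⧸ Subgroup.center (Gqs L v)))
  (keys : ∀ (ξ : OneDimAutRepH L) (v : HeightOneSpectrum (𝓞 ↥(maximalRealSubfield L))),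
    (∀ w : PlacesOver L v, IsCMField.complexConj L • w.1 = w.1) →
      {p : IrrClass (Gqs L v) × IrrClass (Gqs L v) //
        KeysCaseTwoLabels L v (μω.semilocalComponent L v) (torusLocalComponent L (IsCMField.complexConj L) v ξ.η)
          (torusLocalComponent L (IsCMField.complexConj L) v ξ.ψ) p.1 p.2 ∧
        p.1.IsSquareIntegrable (μZ v) ∧ ¬ p.2.IsSquareIntegrable (μZ v)})
  (hSC : ∀ (ξ : OneDimAutRepH L) (v : HeightOneSpectrum (𝓞 ↥(maximalRealSubfield L)))
    (hns : ∀ w : PlacesOver L v, IsCMField.complexConj L • w.1 = w.1)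
    (T : GL (Fin 3) (LocalRing L v)) (a : LocalRing L v) (ha : IsUnit a)
    (h : formCongr (conjLocal L (IsCMField.complexConj L) v) T (H.map (algebraMap L (LocalRing L v))) =
      a • (Matrix.of fun i j : Fin 3 => if i.val + j.val + 1 = 3 then (1 : L) else 0).map (algebraMap L (LocalRing L v)))
    (π2 πn : IrrClass (Gqs L v)),
    KeysCaseTwoLabels L v (μω.semilocalComponent L v) (torusLocalComponent L (IsCMField.complexConj L) v ξ.η)
      (torusLocalComponent L (IsCMField.complexConj L) v ξ.ψ) π2 πn → ¬ πn.IsSquareIntegrable (μZ v) →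
    {πs : IrrClass ((cmDatum L 3 H).Local v) // πs.IsSupercuspidal ∧ πs ≠ IrrClass.comap (cmDatumLocalCongr L v T ha h).symm πn})
  {TG TH : Type}
  (μA : Measure (adelicGroupData (↥(maximalRealSubfield L)) L (IsCMField.complexConj L) 3 H).automorphicQuotient)
  [(adelicGroupData (↥(maximalRealSubfield L)) L (IsCMField.complexConj L) 3 H).IsAutomorphicMeasure μA]
  {H' : Matrix (Fin 3) (Fin 3) L}
  (𝔩 : ∀ v : HeightOneSpectrum (𝓞 ↥(maximalRealSubfield L)), LocalPacketKit L H' v)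


/-! ## §1 The slot laws at the SCD record -/

/-- **`πˢ(ξ_v) ≠ πⁿ(ξ_v)` AT A NON-SPLIT PLACE — the letter `hne` at the record**: at a non-split `v` the record is `⟨πⁿ ∘ e, some πˢ⟩` (★ `xiPacketFamilyOfRecordSCD_of_nonsplit`)
with `πˢ` read off the character identity `hSC`, whose own clause says `πˢ ≠ πⁿ ∘ e`. [cite: Rogawski1990, §12.2 (2) pp. 173–174; §13.1 Prop. 13.1.4 p. 199] -/
theorem πs_getD_ne_πn_recordSCD_of_nonsplit (ξ : OneDimAutRepH L) (v : HeightOneSpectrum (𝓞 ↥(maximalRealSubfield L)))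
    (hns : ∀ w : PlacesOver L v, IsCMField.complexConj L • w.1 = w.1) :
    (xiPacketFamilyOfRecordSCD L H hH hHd μω hμu μZ keys hSC ξ v).πs.getD (xiPacketFamilyOfRecordSCD L H hH hHd μω hμu μZ keys hSC ξ v).πn ≠ (xiPacketFamilyOfRecordSCD L H hH hHd μω hμu μZ keys hSC ξ v).πn := by
  obtain ⟨T', a, ha, h, hP, -⟩ := xiPacketFamilyOfRecordSCD_of_nonsplit L H hH hHd μω hμu μZ keys hSC ξ v hns
  rw [hP]
  exact (hSC ξ v hns T' a ha h (keys ξ v hns).1.1 (keys ξ v hns).1.2 (keys ξ v hns).2.1 (keys ξ v hns).2.2.2).2.2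

/-- **`πˢ(ξ_v)` IS SUPERCUSPIDAL AT A NON-SPLIT PLACE** (the record's `hSC` clause). [cite: Rogawski1990, §13.1 Prop. 13.1.3 (d) p. 199; §12.2 (2) p. 174] -/
theorem isSupercuspidal_πs_getD_recordSCD_of_nonsplit (ξ : OneDimAutRepH L) (v : HeightOneSpectrum (𝓞 ↥(maximalRealSubfield L)))
    (hns : ∀ w : PlacesOver L v, IsCMField.complexConj L • w.1 = w.1) :
    ((xiPacketFamilyOfRecordSCD L H hH hHd μω hμu μZ keys hSC ξ v).πs.getD (xiPacketFamilyOfRecordSCD L H hH hHd μω hμu μZ keys hSC ξ v).πn).IsSupercuspidal := by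
  obtain ⟨T', a, ha, h, hP, -⟩ := xiPacketFamilyOfRecordSCD_of_nonsplit L H hH hHd μω hμu μZ keys hSC ξ v hns
  rw [hP]
  exact (hSC ξ v hns T' a ha h (keys ξ v hns).1.1 (keys ξ v hns).1.2 (keys ξ v hns).2.1 (keys ξ v hns).2.2.2).2.1

/-- **`πˢ(ξ_v)` IS UNITARIZABLE AT A NON-SPLIT PLACE — the letter `hus` at the record**: supercuspidal (above) with compact centre (`U(H)(L⁺_v)` at a non-split `v`: ★
`local_nonsplit_compactOpen_center_of_center_le` + ★ `forall_mem_center_cmLocal_eq_scalar`) ⟹ unitarizable (★ `isUnitarizable_of_isSupercuspidal`).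
[cite: Rogawski1990, §13.1 Prop. 13.1.3 (d) p. 199] [cite: BushnellHenniart2006, §11.1] -/
theorem isUnitarizable_πs_getD_recordSCD_of_nonsplit (ξ : OneDimAutRepH L) (v : HeightOneSpectrum (𝓞 ↥(maximalRealSubfield L)))
    (hns : ∀ w : PlacesOver L v, IsCMField.complexConj L • w.1 = w.1) :
    ((xiPacketFamilyOfRecordSCD L H hH hHd μω hμu μZ keys hSC ξ v).πs.getD (xiPacketFamilyOfRecordSCD L H hH hHd μω hμu μZ keys hSC ξ v).πn).IsUnitarizable := by
  obtain ⟨⟨K₀, hK₀o, hK₀c⟩, hZ⟩ := F0P3bLocalNonsplitCompactCenter.local_nonsplit_compactOpen_center_of_center_le L 3 H hHd v hns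
    (UnitaryGroup.forall_mem_center_cmLocal_eq_scalar L H hH hHd v hns)
  exact F0P3bSupercuspidalUnitarizable.isUnitarizable_of_isSupercuspidal hK₀o hK₀c hZ _
    (isSupercuspidal_πs_getD_recordSCD_of_nonsplit L H hH hHd μω hμu μZ keys hSC ξ v hns)

/-- **`πⁿ(ξ_v)` IS UNITARIZABLE AT EVERY PLACE — the letter `hun` at the record** (`μω|_{𝕀_{L⁺}} = ω`, Haar frame on the `μZ v`): ★ `hFinU_of_xiLocalPacketUnitarySCD` at the
letter `XiLocalPacketUnitary`, itself ★ from letter D (★ `xiLocalPacketUnitary_of_letterD` at ★ `xiLocalPacket_nonsplit_isThetaPair_holds`): split `v` — the D6 member is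
unitarily induced from unit-norm characters; non-split `v` — the Keys label is a theta type, transported along the form congruence.
[cite: Rogawski1990, §12.2 (1)–(2) pp. 173–174; §4.13 Lemma 4.13.1 (b)] [cite: GelbartRogawski1991, Lem. 5.1.2 p. 466] -/
theorem isUnitarizable_πn_recordSCD
    (hμω : ∀ x : Literature.NumberTheory.GaloisRepresentations.ideleGroup ↥(maximalRealSubfield L),
      μω (AdeleRing.ideleBaseChange (↥(maximalRealSubfield L)) L x) = quadraticHeckeCharCM L x)
    [∀ v : HeightOneSpectrum (𝓞 ↥(maximalRealSubfield L)), BorelSpace (Gqs L v ⧸ Subgroup.center (Gqs L v))]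
    [∀ v : HeightOneSpectrum (𝓞 ↥(maximalRealSubfield L)), (μZ v).IsHaarMeasure]
    (ξ : OneDimAutRepH L) (v : HeightOneSpectrum (𝓞 ↥(maximalRealSubfield L))) :
    ((xiPacketFamilyOfRecordSCD L H hH hHd μω hμu μZ keys hSC ξ v).πn).IsUnitarizable :=
  (F0P3XiSideOfRecordSCD.hFinU_of_xiLocalPacketUnitarySCD L H hH hHd μω hμu μZ keys hSC
    (F0P3bXiLocalPacketUnitaryOfStubs.xiLocalPacketUnitary_of_letterD L H hH hHd μω hμu hμω μZ keys
      F0P2oLocalLettersHold.xiLocalPacket_nonsplit_isThetaPair_holds) ξ v).1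

/-! ## §2 The (CMP) binder with the slot letters paid -/

include hdef hν hμ in
/-- **(CMP-L3) `hcoeffMem_binder_gammaSph_recordSCD_ofLevels_unit_slots'` — ★ (CMP-L2) `…_ofLevels_unit'` (p862816) WITH `hun hus hne` DISCHARGED at the record (§1).**
`hexc` DISCHARGED by ★ `hexc_of_xiPinSphericalCofinite` at ★ `xiPinSphericalCofinite_holds` (letter #79, Thm. 13.3.6 (b)).  New binders instead: `hp` (the two-member places
`p ξ h₁` are non-split — `fun _ _ _ h => h` at `p := non-split`), `hμω` ((δ1) :116), the Haar frame on `μZ` ((δ1) :155–:158), `hquad` (B's `keys`-pin clause).  Everything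
else — and the CONCLUSION, the (δ1)∕(δ5) `hcoeffMem` binder type token for token — as in ★ `…_ofLevels_unit'`.
[cite: Rogawski1990, §14.6 Thm. 14.6.4 with its proof pp. 244–245 (chunks p0238 L9 – p0239 L4); §12.2 (1)–(2) pp. 173–174; §13.1 Prop. 13.1.3 (d) p. 199; §13.3 Thm. 13.3.5 p. 202] [cite: GelbartRogawski1991, Lem. 5.1.2 p. 466] [cite: FlathCorvallis1979, Thm. 3 and Thm. 4] -/
theorem hcoeffMem_binder_gammaSph_recordSCD_ofLevels_unit_slots'
    (hμω : ∀ x : Literature.NumberTheory.GaloisRepresentations.ideleGroup ↥(maximalRealSubfield L),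
      μω (AdeleRing.ideleBaseChange (↥(maximalRealSubfield L)) L x) = quadraticHeckeCharCM L x)
    (hquad : ∀ v : HeightOneSpectrum (𝓞 ↥(maximalRealSubfield L)), (∀ w : PlacesOver L v, IsCMField.complexConj L • w.1 = w.1) →
      IsQuadraticCharExtension (conjLocal L (IsCMField.complexConj L) v) (μω.semilocalComponent L v))
    [∀ v : HeightOneSpectrum (𝓞 ↥(maximalRealSubfield L)), BorelSpace (Gqs L v ⧸ Subgroup.center (Gqs L v))]
    [∀ v : HeightOneSpectrum (𝓞 ↥(maximalRealSubfield L)), (μZ v).IsHaarMeasure]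
    (hanis : ∀ x : Fin 3 → L, Literature.AlgebraicGeometry.ShimuraVarieties.hermForm (cmConjRingHom L) H x x = 0 → x = 0)
    (hF1b : ∀ P₀ Q₀ : DiscreteAutomorphicRep (adelicGroupData (↥(maximalRealSubfield L)) L (IsCMField.complexConj L) 3 H) μA,
      IsKcSpherical L ι₀ H T hT μA P₀ → IsKcSpherical L ι₀ H T hT μA Q₀ →
      P₀.UnitaryEquivOfComponents Q₀ (uFormGroup (Fin 2) (Fin 1)) (cmArchSectionUForm L ι₀ H T hT) (cmCompactFactor L ι₀ H T hT))
    (hARCH : ArchComponentOfDiscrete L ι₀ H T hT μA)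
    (X : DatumInputs ((UnitaryGroup.arch (↥(maximalRealSubfield L)) L (IsCMField.complexConj L) 3 H → ℂ) ×
        (∀ v : HeightOneSpectrum (𝓞 ↥(maximalRealSubfield L)), (cmDatum L 3 H).Local v → ℂ)) TG TH L ι₀ H T hT μA (xiPacketFamilyOfRecordSCD L H hH hHd μω hμu μZ keys hSC) 𝔩)
    (Transfer : (UnitaryGroup.arch (↥(maximalRealSubfield L)) L (IsCMField.complexConj L) 3 H → ℂ) ×
        (∀ v : HeightOneSpectrum (𝓞 ↥(maximalRealSubfield L)), (cmDatum L 3 H).Local v → ℂ) → TG → Prop)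
    (TransferH : (UnitaryGroup.arch (↥(maximalRealSubfield L)) L (IsCMField.complexConj L) 3 H → ℂ) ×
        (∀ v : HeightOneSpectrum (𝓞 ↥(maximalRealSubfield L)), (cmDatum L 3 H).Local v → ℂ) → TH → Prop)
    (htrX : ∀ (π' : RepPrimeSph L ι₀ H T hT μA) (φf : (UnitaryGroup.arch (↥(maximalRealSubfield L)) L (IsCMField.complexConj L) 3 H → ℂ) ×
        (∀ v : HeightOneSpectrum (𝓞 ↥(maximalRealSubfield L)), (cmDatum L 3 H).Local v → ℂ)),
      X.trPrime π' φf = archTr₀ L ι₀ H T hT νinf (tupleOf L ι₀ H T hT μA π').1 φf.1 *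
        ∏ᶠ v, (letI : MeasurableSpace ((cmDatum L 3 H).Local v) := borel _;
          ((tupleOf L ι₀ H T hT μA π').2 v).smoothTrace (μv v) (φf.2 v)))
    -- the per-`(P, ξ)` letters, ∀-closed
    (p : ∀ ξ : X.G.PacketH, X.IsOneDimH ξ → HeightOneSpectrum (𝓞 ↥(maximalRealSubfield L)) → Prop)
    -- NEW: the two-member places are NON-SPLIT (print §12.2 (2): `Π(ξ_v) = {πⁿ, πˢ}` iff `v` does not split in `L/L⁺`; at `p := non-split` this is `fun _ _ _ h => h`)
    (hp : ∀ (ξ : X.G.PacketH) (h₁ : X.IsOneDimH ξ) (v : HeightOneSpectrum (𝓞 ↥(maximalRealSubfield L))), p ξ h₁ v →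
      ∀ w : PlacesOver L v, IsCMField.complexConj L • w.1 = w.1)
    (a₀ : ∀ ξ : X.G.PacketH, X.IsOneDimH ξ → GKIrrClass (uFormGroup (Fin 2) (Fin 1)))
    (ha₀ : ∀ (ξ : X.G.PacketH) (h₁ : X.IsOneDimH ξ), ∃ r : GKIrrep (uFormGroup (Fin 2) (Fin 1)), GKIrrClass.mk r = a₀ ξ h₁ ∧ IsAdmissibleGK r.ρK ∧ r.IsInfUnitaryAlongP)
    (T₀ : ∀ ξ : X.G.PacketH, X.IsOneDimH ξ → (UnitaryGroup.arch (↥(maximalRealSubfield L)) L (IsCMField.complexConj L) 3 H → ℂ) ×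
        (∀ v : HeightOneSpectrum (𝓞 ↥(maximalRealSubfield L)), (cmDatum L 3 H).Local v → ℂ) →
      Finset (HeightOneSpectrum (𝓞 ↥(maximalRealSubfield L))))
    (hn1 : ∀ (ξ : X.G.PacketH) (h₁ : X.IsOneDimH ξ), ∀ φf, (ArchTestKc L ι₀ H T hT φf.1 ∧ (∀ v, IsLocallyConstant (φf.2 v) ∧ HasCompactSupport (φf.2 v)) ∧ {v | φf.2 v ≠ (((μv v).real (cmLocalIntegralLevel L 3 H v : Set ((cmDatum L 3 H).Local v)) : ℂ))⁻¹ •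
          (cmLocalIntegralLevel L 3 H v : Set ((cmDatum L 3 H).Local v)).indicator fun _ => (1 : ℂ)}.Finite) →
      ∀ v ∉ T₀ ξ h₁ φf, (letI : MeasurableSpace ((cmDatum L 3 H).Local v) := borel _;
        (((xiPacketFamilyOfRecordSCD L H hH hHd μω hμu μZ keys hSC) (X.oneDimOf ξ h₁) v).πn).smoothTrace (μv v) (φf.2 v)) = 1)
    (hs0 : ∀ (ξ : X.G.PacketH) (h₁ : X.IsOneDimH ξ), ∀ φf, (ArchTestKc L ι₀ H T hT φf.1 ∧ (∀ v, IsLocallyConstant (φf.2 v) ∧ HasCompactSupport (φf.2 v)) ∧ {v | φf.2 v ≠ (((μv v).real (cmLocalIntegralLevel L 3 H v : Set ((cmDatum L 3 H).Local v)) : ℂ))⁻¹ •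
          (cmLocalIntegralLevel L 3 H v : Set ((cmDatum L 3 H).Local v)).indicator fun _ => (1 : ℂ)}.Finite) →
      ∀ i : {v // p ξ h₁ v}, (i : HeightOneSpectrum (𝓞 ↥(maximalRealSubfield L))) ∉ T₀ ξ h₁ φf →
        (letI : MeasurableSpace ((cmDatum L 3 H).Local i) := borel _;
          (((xiPacketFamilyOfRecordSCD L H hH hHd μω hμu μZ keys hSC) (X.oneDimOf ξ h₁) (i : _)).πs.getD ((xiPacketFamilyOfRecordSCD L H hH hHd μω hμu μZ keys hSC) (X.oneDimOf ξ h₁) (i : _)).πn).smoothTrace (μv i) (φf.2 i)) = 0)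
    (hR₁ : ∀ (P : X.G.Packet) (ξ : X.G.PacketH) (h₁ : X.IsOneDimH ξ), X.G.IsAPacket P → X.G.liftsTo ξ P →
      ∀ φf (f : TG), (ArchTestKc L ι₀ H T hT φf.1 ∧ (∀ v, IsLocallyConstant (φf.2 v) ∧ HasCompactSupport (φf.2 v)) ∧ {v | φf.2 v ≠ (((μv v).real (cmLocalIntegralLevel L 3 H v : Set ((cmDatum L 3 H).Local v)) : ℂ))⁻¹ •
          (cmLocalIntegralLevel L 3 H v : Set ((cmDatum L 3 H).Local v)).indicator fun _ => (1 : ℂ)}.Finite) →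
      Transfer φf f →
      X.G.packetTrace X.tr P f =
        (-1) ^ (gammaSph _ TG TH L ι₀ H T hT μA (xiPacketFamilyOfRecordSCD L H hH hHd μω hμu μZ keys hSC) 𝔩 X).N *
          (archTr₀ L ι₀ H T hT νinf (a₀ ξ h₁) φf.1 *
            ∏ v ∈ T₀ ξ h₁ φf with ¬ p ξ h₁ v, (letI : MeasurableSpace ((cmDatum L 3 H).Local v) := borel _;
              (((xiPacketFamilyOfRecordSCD L H hH hHd μω hμu μZ keys hSC) (X.oneDimOf ξ h₁) v).πn).smoothTrace (μv v) (φf.2 v))) *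
          ∏ i ∈ (T₀ ξ h₁ φf).subtype (p ξ h₁), (letI : MeasurableSpace ((cmDatum L 3 H).Local i) := borel _;
            ((((xiPacketFamilyOfRecordSCD L H hH hHd μω hμu μZ keys hSC) (X.oneDimOf ξ h₁) (i : _)).πn).smoothTrace (μv i) (φf.2 i) -
              (((xiPacketFamilyOfRecordSCD L H hH hHd μω hμu μZ keys hSC) (X.oneDimOf ξ h₁) (i : _)).πs.getD ((xiPacketFamilyOfRecordSCD L H hH hHd μω hμu μZ keys hSC) (X.oneDimOf ξ h₁) (i : _)).πn).smoothTrace (μv i) (φf.2 i))))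
    (hR₂ : ∀ (ξ : X.G.PacketH) (h₁ : X.IsOneDimH ξ), ∀ φf (fH : TH), (ArchTestKc L ι₀ H T hT φf.1 ∧ (∀ v, IsLocallyConstant (φf.2 v) ∧ HasCompactSupport (φf.2 v)) ∧ {v | φf.2 v ≠ (((μv v).real (cmLocalIntegralLevel L 3 H v : Set ((cmDatum L 3 H).Local v)) : ℂ))⁻¹ •
          (cmLocalIntegralLevel L 3 H v : Set ((cmDatum L 3 H).Local v)).indicator fun _ => (1 : ℂ)}.Finite) →
      TransferH φf fH →
      X.trH ξ fH =
        (-1) ^ (gammaSph _ TG TH L ι₀ H T hT μA (xiPacketFamilyOfRecordSCD L H hH hHd μω hμu μZ keys hSC) 𝔩 X).N * (gammaSph _ TG TH L ι₀ H T hT μA (xiPacketFamilyOfRecordSCD L H hH hHd μω hμu μZ keys hSC) 𝔩 X).c *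
          (archTr₀ L ι₀ H T hT νinf (a₀ ξ h₁) φf.1 *
            ∏ v ∈ T₀ ξ h₁ φf with ¬ p ξ h₁ v, (letI : MeasurableSpace ((cmDatum L 3 H).Local v) := borel _;
              (((xiPacketFamilyOfRecordSCD L H hH hHd μω hμu μZ keys hSC) (X.oneDimOf ξ h₁) v).πn).smoothTrace (μv v) (φf.2 v))) *
          ∏ i ∈ (T₀ ξ h₁ φf).subtype (p ξ h₁), (letI : MeasurableSpace ((cmDatum L 3 H).Local i) := borel _;
            ((((xiPacketFamilyOfRecordSCD L H hH hHd μω hμu μZ keys hSC) (X.oneDimOf ξ h₁) (i : _)).πn).smoothTrace (μv i) (φf.2 i) +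
              (((xiPacketFamilyOfRecordSCD L H hH hHd μω hμu μZ keys hSC) (X.oneDimOf ξ h₁) (i : _)).πs.getD ((xiPacketFamilyOfRecordSCD L H hH hHd μω hμu μZ keys hSC) (X.oneDimOf ξ h₁) (i : _)).πn).smoothTrace (μv i) (φf.2 i))))
    -- the guarded level tuple (shared with `hmn_of_levels'`) and the packet laws
    {Λ : Type} (𝓕 : Λ → ((UnitaryGroup.arch (↥(maximalRealSubfield L)) L (IsCMField.complexConj L) 3 H → ℂ) ×
        (∀ v : HeightOneSpectrum (𝓞 ↥(maximalRealSubfield L)), (cmDatum L 3 H).Local v → ℂ)) → Prop)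
    (hsum𝓕 : ∀ (l : Λ) (f' : (UnitaryGroup.arch (↥(maximalRealSubfield L)) L (IsCMField.complexConj L) 3 H → ℂ) ×
        (∀ v : HeightOneSpectrum (𝓞 ↥(maximalRealSubfield L)), (cmDatum L 3 H).Local v → ℂ)),
      𝓕 l f' → Summable (fun π' : (InnerFormSec146.RepPrimeSph L ι₀ H T hT μA) => (InnerFormSec146.mPrimeSph L ι₀ H T hT μA π' : ℂ) * X.trPrime π' f'))
    {E : Λ → Type}
    (tR : ∀ l, (InnerFormSec146.RepPrimeSph L ι₀ H T hT μA) → Option (E l)) (tP : ∀ l, X.G.Packet → Option (E l))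
    (hcover : ∀ (f' : (UnitaryGroup.arch (↥(maximalRealSubfield L)) L (IsCMField.complexConj L) 3 H → ℂ) ×
        (∀ v : HeightOneSpectrum (𝓞 ↥(maximalRealSubfield L)), (cmDatum L 3 H).Local v → ℂ)) (f : TG) (P : X.G.Packet),
      Transfer f' f → ∃ (l : Λ) (e : E l), 𝓕 l f' ∧ tP l P = some e)
    (hlevT : ∀ (l : Λ) (f' : (UnitaryGroup.arch (↥(maximalRealSubfield L)) L (IsCMField.complexConj L) 3 H → ℂ) ×
        (∀ v : HeightOneSpectrum (𝓞 ↥(maximalRealSubfield L)), (cmDatum L 3 H).Local v → ℂ)) (f : TG) (fH : TH),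
      𝓕 l f' → Transfer f' f → TransferH f' fH →
      ∀ (P : X.G.Packet) (e : E l), tP l P = some e →
        (∑' π' : tR l ⁻¹' {some e}, (InnerFormSec146.mPrimeSph L ι₀ H T hT μA (π' : InnerFormSec146.RepPrimeSph L ι₀ H T hT μA) : ℂ) * X.trPrime π' f') =
          X.G.n P * X.G.packetTrace X.tr P f + 1 / 2 * X.G.endoSum X.trH P fH)
    (hgerm : ∀ l (π' : (InnerFormSec146.RepPrimeSph L ι₀ H T hT μA)) (P : X.G.Packet) (e : E l), tP l P = some e → tR l π' = some e →
      InnerFormSec146.evpRep L H μA 𝔩 π'.1 (X.finOfG P))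
    (hrig : ∀ (l : Λ) (f' : (UnitaryGroup.arch (↥(maximalRealSubfield L)) L (IsCMField.complexConj L) 3 H → ℂ) ×
        (∀ v : HeightOneSpectrum (𝓞 ↥(maximalRealSubfield L)), (cmDatum L 3 H).Local v → ℂ)),
      𝓕 l f' → ∀ (π' : (InnerFormSec146.RepPrimeSph L ι₀ H T hT μA)) (P : X.G.Packet) (e : E l), tP l P = some e →
        InnerFormSec146.evpRep L H μA 𝔩 π'.1 (X.finOfG P) → (InnerFormSec146.mPrimeSph L ι₀ H T hT μA π' : ℂ) * X.trPrime π' f' ≠ 0 → tR l π' = some e)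
    (hlifts : ∀ (P : X.G.Packet) (ξ : X.G.PacketH), X.G.IsAPacket P → X.IsOneDimH ξ → X.G.liftsTo ξ P → X.G.lifts P = {ξ})
    (hn : ∀ (P : X.G.Packet) (ξ : X.G.PacketH), X.G.IsAPacket P → X.IsOneDimH ξ → X.G.liftsTo ξ P → X.G.n P = 1 / 2)
    (hnH : ∀ ξ : X.G.PacketH, X.IsOneDimH ξ → X.G.nH ξ = 1)
    (hex : ∀ φf, (ArchTestKc L ι₀ H T hT φf.1 ∧ (∀ v, IsLocallyConstant (φf.2 v) ∧ HasCompactSupport (φf.2 v)) ∧ {v | φf.2 v ≠ (((μv v).real (cmLocalIntegralLevel L 3 H v : Set ((cmDatum L 3 H).Local v)) : ℂ))⁻¹ •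
          (cmLocalIntegralLevel L 3 H v : Set ((cmDatum L 3 H).Local v)).indicator fun _ => (1 : ℂ)}.Finite) →
      ∃ (f : TG) (fH : TH), Transfer φf f ∧ TransferH φf fH) :
    InnerFormSec146.DSplit L H → ∀ (P : X.G.Packet) (ξ : X.G.PacketH) (h₁ : X.IsOneDimH ξ)
      (hS : ∀ v : InnerFormSec146.Place L, v ∈ InnerFormSec146.S0 L H → X.MnNeZero ξ v),
      X.G.IsAPacket P → X.G.liftsTo ξ P → ∀ π' : (InnerFormSec146.RepPrimeSph L ι₀ H T hT μA), InnerFormSec146.evpRep L H μA 𝔩 π'.1 (X.finOfG P) →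
        InnerFormSec146.mPrimeSph L ι₀ H T hT μA π' ≠ 0 →
          InnerFormSec146.memPrime L H μA (xiPacketFamilyOfRecordSCD L H hH hHd μω hμu μZ keys hSC) π'.1
            (InnerFormSec146.piXiPrime L H μA (xiPacketFamilyOfRecordSCD L H hH hHd μω hμu μZ keys hSC) (X.oneDimOf ξ h₁)) :=
  hcoeffMem_binder_gammaSph_recordSCD_ofLevels_unit' L ι₀ H T hT νinf μv hdef hν hμ hH hHd μω hμu μZ keys hSC μA 𝔩
    hanis hF1b hARCH X Transfer TransferH htrX p a₀ ha₀
    (fun ξ h₁ v => isUnitarizable_πn_recordSCD L H hH hHd μω hμu μZ keys hSC hμω (X.oneDimOf ξ h₁) v)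
    (fun ξ h₁ v hv => isUnitarizable_πs_getD_recordSCD_of_nonsplit L H hH hHd μω hμu μZ keys hSC (X.oneDimOf ξ h₁) v (hp ξ h₁ v hv))
    (fun ξ h₁ i => πs_getD_ne_πn_recordSCD_of_nonsplit L H hH hHd μω hμu μZ keys hSC (X.oneDimOf ξ h₁) i (hp ξ h₁ i i.2))
    T₀ hn1 hs0 hR₁ hR₂ 𝓕 hsum𝓕 tR tP hcover hlevT hgerm hrig hlifts hn hnH hex
    (fun ξ h₁ => F0P3XiPacketFamilyOfRecord.hexc_of_xiPinSphericalCofinite L μω hμu μZ keys hquad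
      (F0P3XiPinSphericalCofiniteHolds.xiPinSphericalCofinite_holds L) (X.oneDimOf ξ h₁))

end Record

end Summit.HodgeConjecture.HodgeConjecture.R90.S9

end
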